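import Summits.Ventures.CertifiedManyBodySolver.Observables.PairLROTowerCeiling
import HarnessLib

/-!
# The Koma–Tasaki tower witness on ONE torus, with its four numerics exposed (unit; one-point amplitude;
# energy; spin fillings)

HONEST FRAMING: soundness bookkeeping for a CEILING route at positivity scale; a ceiling never speaks to the
presence of pairing; not a superconductivity verdict; nothing in this file is a number. Crew hubbard-obs
(D-0042), seat hubbard-obs-gs-2 (`prover-hubbard-obs-gs-2-g3-0`). Zero compute; no definition; no named fact;
no `sorry`.

`PairLROTowerCeiling.tower_finite_step` builds, from a unit sector ground state `ψ` of `hubbardTorusTT' L t t' U`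
with pair LRO `c₀L⁴ ≤ Re⟨ψ, Δ_g†Δ_g ψ⟩`, the height-`k` charge tower (`exists_towerWitness`) and immediately
CONSUMES a one-point variational bound in it. To pass to the torus LIMIT of the witness family (companion file
`PairLROTowerWitnessGroundState.lean`: the limits are translation-invariant ground states of `H^{tt'} − μN`, which
licenses every ground-state row on the cell's one-point objects) one needs the witness vector itself:

* `exists_towerWitnessAt` — a unit vector `Ξ` with `Re⟨Ξ, Δ_g Ξ⟩ ≥ (k/(k+1))·L²·√(c₀ − (k+1)C_γ/L²)`,
  `Re⟨Ξ, HΞ⟩ ≤ E + (C_κ/√(c₀/2))·Σ_{i<k}(C_α/√(c₀/2))^i` (`E = minEnergyOn (szSector N 0)`), and spin fillings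
  `Re⟨Ξ, N_σ Ξ⟩ = N/2 + k/2`, from the three model constants `‖Δ†φ‖ ≤ C_αL²‖φ‖`, `‖(HΔ† − Δ†H)φ‖ ≤ C_κL²‖φ‖`,
  `|Re⟨φ,[Δ,Δ†]φ⟩| ≤ C_γL²` and a side with `(k+1)C_γ ≤ (c₀/2)L²` (the first half of `tower_finite_step`, verbatim).

References: T. Koma, H. Tasaki, J. Stat. Phys. 76 (1994) 745–803, Theorem 5 and §4 [KomaTasaki1994].
-/

noncomputable section

namespace Summit.Ventures.CertifiedManyBodySolver.Observables

open Matrix Complex Finset Literature.MathematicalPhysics.QuantumLattice Literature.Probability.LatticeModels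
open Literature.MathematicalPhysics.QuantumLattice.HubbardWave0 ThermodynamicLimit Filter Topology
open Literature.MathematicalPhysics.QuantumManyBody.StateRelaxation
open scoped ComplexOrder ComplexConjugate BigOperators

/-! ### §1  One torus: the tower witness and its numerics -/

section Finite

variable {L : ℕ} [NeZero L] (g : Site 2 → ℝ)

/-- **The tower witness on one torus.** For a unit sector ground state `ψ` (sector `(N, S^z = 0)`) of
`H = hubbardTorusTT' L t t' U` with LRO floor `c₀L⁴ ≤ Re⟨ψ, Δ†Δ ψ⟩` (`c₀ > 0`), the constants
`‖Δ†φ‖ ≤ C_αL²‖φ‖`, `‖(HΔ† − Δ†H)φ‖ ≤ C_κL²‖φ‖`, `|Re⟨φ,[Δ,Δ†]φ⟩| ≤ C_γL²` (unit `φ`) and a side with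
`(k+1)C_γ ≤ (c₀/2)L²`, there is a unit vector `Ξ` (the height-`k` Koma–Tasaki tower on `ψ`) with one-point
amplitude `Re⟨Ξ, Δ_g Ξ⟩ ≥ (k/(k+1))·L²·√(c₀ − (k+1)C_γ/L²)`, energy
`Re⟨Ξ, HΞ⟩ ≤ E + (C_κ/√(c₀/2))·Σ_{i<k}(C_α/√(c₀/2))^i`, `E = minEnergyOn (szSector N 0)`, and spin fillings
`Re⟨Ξ, N_σ Ξ⟩ = N/2 + k/2`. [cite: KomaTasaki1994, Theorem 5 and §4] -/
theorem exists_towerWitnessAt (t t' U : ℝ) {N : ℕ} {ψ : Fock (Orb (FermionTorus 2 L))}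
    (hψ1 : star ψ ⬝ᵥ ψ = 1) (hgs : IsGroundStateInSector (hubbardTorusTT' L t t' U) N 0 ψ)
    {c₀ Cα Cκ Cγ : ℝ} (hc₀ : 0 < c₀) (hCα : 0 ≤ Cα) (hCκ : 0 ≤ Cκ) (hCγ : 0 ≤ Cγ) (k : ℕ)
    (hα : ∀ φ : Fock (Orb (FermionTorus 2 L)),
      eucNorm ((pairField g L)ᴴ *ᵥ φ) ≤ Cα * (L : ℝ) ^ 2 * eucNorm φ)
    (hκ' : ∀ φ : Fock (Orb (FermionTorus 2 L)),
      eucNorm ((hubbardTorusTT' L t t' U * (pairField g L)ᴴ - (pairField g L)ᴴ * hubbardTorusTT' L t t' U) *ᵥ φ) ≤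
        Cκ * (L : ℝ) ^ 2 * eucNorm φ)
    (hγ : ∀ φ : Fock (Orb (FermionTorus 2 L)), star φ ⬝ᵥ φ = 1 →
      |(expect (pairField g L * (pairField g L)ᴴ - (pairField g L)ᴴ * pairField g L) φ).re| ≤ Cγ * (L : ℝ) ^ 2)
    (hlro : c₀ * (L : ℝ) ^ 4 ≤ (expect ((pairField g L)ᴴ * pairField g L) ψ).re)
    (hLbig : (k + 1) * Cγ ≤ (c₀ / 2) * (L : ℝ) ^ 2) :
    ∃ Ξ : Fock (Orb (FermionTorus 2 L)), star Ξ ⬝ᵥ Ξ = 1 ∧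
      (k : ℝ) / (k + 1) * ((L : ℝ) ^ 2 * Real.sqrt (c₀ - (k + 1) * Cγ / (L : ℝ) ^ 2)) ≤
        (star Ξ ⬝ᵥ (pairField g L *ᵥ Ξ)).re ∧
      (star Ξ ⬝ᵥ (hubbardTorusTT' L t t' U *ᵥ Ξ)).re ≤
        (hubbardTorusTT' L t t' U).minEnergyOn (szSector N 0) +
          (Cκ / Real.sqrt (c₀ / 2)) * ∑ i ∈ Finset.range k, (Cα / Real.sqrt (c₀ / 2)) ^ i ∧
      ∀ σ : Fin 2, (star Ξ ⬝ᵥ ((∑ y : FermionTorus 2 L, numberOp y σ) *ᵥ Ξ)).re = (N : ℝ) / 2 + k / 2 := by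
  set H := hubbardTorusTT' L t t' U with hH
  set P := pairField g L with hP
  set E : ℝ := H.minEnergyOn (szSector N 0) with hE
  have hL : (0 : ℝ) < (L : ℝ) := Nat.cast_pos.2 (Nat.pos_of_ne_zero (NeZero.ne L))
  have hL2 : (0 : ℝ) < (L : ℝ) ^ 2 := by positivity
  have hHN : H * totalNumber = totalNumber * H := (hubbardTorusTT'_commute_totalNumber L t t' U).eq
  have hNA : (totalNumber : Matrix _ _ ℂ) * Pᴴ - Pᴴ * totalNumber = ((2 : ℝ) : ℂ) • Pᴴ := by
    have h := commutator_conjTranspose_of_commutator totalNumber_isHermitian (totalNumber_commutator_pairField g L)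
    rw [neg_neg] at h; exact h
  have hHψ : H *ᵥ ψ = (E : ℂ) • ψ := hgs.2.2
  have hNψ : (totalNumber : Matrix _ _ ℂ) *ᵥ ψ = ((N : ℝ) : ℂ) • ψ := by
    rw [totalNumber_mulVec_of_isNParticle ((mem_szSector_iff _ _ ψ).1 hgs.1).1]; push_cast; rfl
  set α : ℝ := Cα * (L : ℝ) ^ 2 with hαdef
  set κ₁ : ℝ := Cκ * (L : ℝ) ^ 2 with hκ₁def
  set β : ℝ := Cγ * (L : ℝ) ^ 2 with hβdef
  have hβ' : ∀ φ : Fock (Orb (FermionTorus 2 L)),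
      |(star φ ⬝ᵥ ((Pᴴ * Pᴴᴴ - Pᴴᴴ * Pᴴ) *ᵥ φ)).re| ≤ β * eucNorm φ ^ 2 := by
    intro φ
    rw [conjTranspose_conjTranspose]
    have hunit : ∀ ψ' : Fock (Orb (FermionTorus 2 L)), star ψ' ⬝ᵥ ψ' = 1 →
        |(star ψ' ⬝ᵥ ((Pᴴ * P - P * Pᴴ) *ᵥ ψ')).re| ≤ β := by
      intro ψ' h1
      have h := hγ ψ' h1
      have e : (Pᴴ * P - P * Pᴴ) = -(P * Pᴴ - Pᴴ * P) := by abel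
      rw [e, neg_mulVec, dotProduct_neg, Complex.neg_re, abs_neg]
      exact h
    exact abs_re_quadForm_le_of_unit hunit φ
  set ρ : ℝ := (L : ℝ) ^ 2 * Real.sqrt (c₀ - (k + 1) * Cγ / (L : ℝ) ^ 2) with hρdef
  have hinside : c₀ / 2 ≤ c₀ - (k + 1) * Cγ / (L : ℝ) ^ 2 := by
    have h1 : (k + 1) * Cγ / (L : ℝ) ^ 2 ≤ c₀ / 2 := by
      rw [div_le_iff₀ hL2]; exact hLbig
    linarith
  have hρpos : 0 < ρ := by
    have : 0 < Real.sqrt (c₀ - (k + 1) * Cγ / (L : ℝ) ^ 2) := Real.sqrt_pos.2 (by linarith)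
    positivity
  have hρ2 : ρ ^ 2 + k * β ≤ eucNorm (Pᴴ *ᵥ ψ) ^ 2 := by
    have e1 : eucNorm (Pᴴ *ᵥ ψ) ^ 2 = (expect (P * Pᴴ) ψ).re := by
      rw [eucNorm_sq, star_mulVec, conjTranspose_conjTranspose, ← dotProduct_mulVec, mulVec_mulVec]; rfl
    have e2 : ρ ^ 2 = c₀ * (L : ℝ) ^ 4 - (k + 1) * Cγ * (L : ℝ) ^ 2 := by
      rw [hρdef, mul_pow, Real.sq_sqrt (by linarith)]
      field_simp
    have h3 : (expect (Pᴴ * P) ψ).re - Cγ * (L : ℝ) ^ 2 ≤ (expect (P * Pᴴ) ψ).re := by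
      have h := (abs_le.1 (hγ ψ hψ1)).1
      have e : expect (P * Pᴴ - Pᴴ * P) ψ = expect (P * Pᴴ) ψ - expect (Pᴴ * P) ψ := by
        simp [Literature.MathematicalPhysics.QuantumLattice.expect, sub_mulVec, dotProduct_sub]
      rw [e, Complex.sub_re] at h
      linarith
    rw [e1, e2, hβdef]
    nlinarith [hlro, h3]
  obtain ⟨Ξ, hΞ1, -, hΞP, hΞH, hΞG⟩ := exists_towerWitness totalNumber_isHermitian hHN
    (by norm_num : (2 : ℝ) ≠ 0) hNA hψ1 hHψ hNψ (by positivity : 0 ≤ α) hα (by positivity : 0 ≤ κ₁) hκ'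
    (by positivity : 0 ≤ β) hβ' k hρpos hρ2
  rw [conjTranspose_conjTranspose] at hΞP
  have hΞN : ∀ σ : Fin 2, (star Ξ ⬝ᵥ ((∑ y : FermionTorus 2 L, numberOp y σ) *ᵥ Ξ)).re = (N : ℝ) / 2 + k / 2 := by
    intro σ
    have hGA : (∑ y : FermionTorus 2 L, numberOp y σ) * Pᴴ - Pᴴ * (∑ y : FermionTorus 2 L, numberOp y σ) =
        ((1 : ℝ) : ℂ) • Pᴴ := by
      have h := commutator_conjTranspose_of_commutator (spinNumber_isHermitian (L := L) σ)
        (spinNumber_commutator_pairField g σ)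
      rw [neg_neg] at h; exact h
    have hGψ := spinNumber_mulVec_of_mem_szSector σ hgs.1
    rw [hΞG _ 1 ((N : ℝ) / 2) hGA hGψ, Complex.ofReal_re]
    ring
  set Dbar : ℝ := (Cκ / Real.sqrt (c₀ / 2)) * ∑ i ∈ Finset.range k, (Cα / Real.sqrt (c₀ / 2)) ^ i with hDbar
  have hsqrt_le : (L : ℝ) ^ 2 * Real.sqrt (c₀ / 2) ≤ ρ := by
    rw [hρdef]
    exact mul_le_mul_of_nonneg_left (Real.sqrt_le_sqrt hinside) hL2.le
  have hs0 : 0 < Real.sqrt (c₀ / 2) := Real.sqrt_pos.2 (by linarith)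
  have hratio1 : κ₁ / ρ ≤ Cκ / Real.sqrt (c₀ / 2) := by
    rw [hκ₁def, div_le_div_iff₀ hρpos hs0]
    calc Cκ * (L : ℝ) ^ 2 * Real.sqrt (c₀ / 2) = Cκ * ((L : ℝ) ^ 2 * Real.sqrt (c₀ / 2)) := by ring
      _ ≤ Cκ * ρ := mul_le_mul_of_nonneg_left hsqrt_le hCκ
  have hratio2 : α / ρ ≤ Cα / Real.sqrt (c₀ / 2) := by
    rw [hαdef, div_le_div_iff₀ hρpos hs0]
    calc Cα * (L : ℝ) ^ 2 * Real.sqrt (c₀ / 2) = Cα * ((L : ℝ) ^ 2 * Real.sqrt (c₀ / 2)) := by ring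
      _ ≤ Cα * ρ := mul_le_mul_of_nonneg_left hsqrt_le hCα
  have hD_le : (κ₁ / ρ) * ∑ i ∈ Finset.range k, (α / ρ) ^ i ≤ Dbar := by
    rw [hDbar]
    refine mul_le_mul hratio1 (Finset.sum_le_sum fun i _ => ?_) (Finset.sum_nonneg fun i _ => by positivity)
      (div_nonneg hCκ hs0.le)
    exact pow_le_pow_left₀ (by positivity) hratio2 i
  have heΞ : (star Ξ ⬝ᵥ (H *ᵥ Ξ)).re ≤ E + Dbar := hΞH.trans (by linarith)
  exact ⟨Ξ, hΞ1, hΞP, heΞ, hΞN⟩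

end Finite

end Summit.Ventures.CertifiedManyBodySolver.Observables

end
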